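import Mathlib
import HarnessLib.Audit
import Summits.PneNP.PneNP.Theorems.PstarChordReadGates
import Summits.PneNP.PneNP.Theorems.PstarNorUnitDirAssembly

/-!
# Double-slice genericity and bi-chord-local readers: the endgame for pinned pairs (ROUND-24, O1 at exact tightness; memo g20 §13.10, residual R3)

FRONTIER range-avoidance ladder, rung F-N3, ROUND 24 (cell `pnp-ideate`, prover-2 memo `g20/O1-CHORD-READ-g20.md` §13.10 (residual R3: coupled
switches; (T3) on the four flips of a coupled pair PINS the base reader pair on a double-slice pattern unless the type is uniform); typed target
`PstarCoreBoundTargets.TerminalPeelable` (p646951); restricted-model proof complexity — nothing here bears on `P` versus `NP`).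

The two-chord analogue of `PstarChordReadLemma`'s slice lemma and endgame:

* `DoubleSliceGeneric I y J₀ cᵢ cⱼ 𝒢` (def) — the per-pair genericity input: a reader with monomials in `𝒢`, not reading the four privates, that
  misses a target at every solution of `J₀ ∖ {cᵢ, cⱼ}` with prescribed `x_{aᵢ} ⊕ x_{bᵢ}` and `x_{aⱼ} ⊕ x_{bⱼ}` depends only on these two bits and on
  the variables OUTSIDE the core (instance form of "rank `NF − β − 6` on the pattern sets"; certificate engine `g20/dslice2.py`, kit j318054);
* `BiChordLocal I J₀ cᵢ cⱼ C G` (def) — the reader depends only on the chord data `(x_{aᵢ}⊕x_{bᵢ}, x_{pᵢ}, x_{qᵢ}, x_{aⱼ}⊕x_{bⱼ}, x_{pⱼ}, x_{qⱼ})`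
  and on the outside variables;
* `biLocal_of_fail_pattern` — DOUBLE-SLICE LEMMA: a reader (monomials avoiding both AND pairs) failing on a private pattern
  `Sol(J₀) ∩ {pᵢ = πᵢ, qᵢ = κᵢ, pⱼ = πⱼ, qⱼ = κⱼ}` is bi-chord-local;
* `false_of_biLocal₂` — ENDGAME: two bi-chord-local readers contradict (T3): copy the chord data of the (M0) witness of a third output into a
  genuine solution (`exists_two_slices`) and its outside values verbatim;
* `false_of_pinned_pattern` — hence a terminal core has no pattern on which BOTH readers miss a value (the pinned branch of memo §13.10 (β)).

No Assumption A.
-/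

set_option linter.dupNamespace false -- `Summit.PneNP.PneNP.…`: summit = sub-problem name (D-0017 single-conjunct layout)

open Finset Literature.Computability.Complexity
open Summit.PneNP.PneNP.Theorems.PstarFibrePolys (bit bit_injective bit_xor)
open Summit.PneNP.PneNP.Theorems.PstarTyped (Typed)
open Summit.PneNP.PneNP.Theorems.PstarSALevel (varSet bdry BoundaryExpanding SimpleOverlap)
open Summit.PneNP.PneNP.Theorems.PstarGapPeeling (eval_congr not_mem_varSet_of_private)
open Summit.PneNP.PneNP.Theorems.PstarCentreFree (vars_mem_varSet)
open Summit.PneNP.PneNP.Theorems.PstarGapOneAll (gval)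
open Summit.PneNP.PneNP.Theorems.PstarChordRepair (IsChord)
open Summit.PneNP.PneNP.Theorems.PstarCoreBoundTargets (Terminal)
open Summit.PneNP.PneNP.Theorems.PstarFreshErase (slots_ne)
open Summit.PneNP.PneNP.Theorems.PstarChordReadsMirror (gval_eq_split gval_update_pq solves_set_privates xor_eq_of_eval)
open Summit.PneNP.PneNP.Theorems.PstarChordReadLemma (SliceGeneric)
open Summit.PneNP.PneNP.Theorems.PstarChordReadGates (exists_two_slices)
open Summit.PneNP.PneNP.Theorems.PstarNorUnitDirAssembly (isChord_of_subset)

namespace Summit.PneNP.PneNP.Theorems.PstarChordReadBiLocal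

variable {n m : ℕ}

/-! ## Definitions -/

/-- The reader `(C, G)` is **BI-CHORD-LOCAL** at `(cᵢ, cⱼ)`: its value depends only on the chord data of the two chords and on the variables outside
the core `J₀`. -/
def BiChordLocal (I : LocalMap 4 n m) (J₀ : Finset (Fin m)) (cᵢ cⱼ : Fin m) (C : Finset (Fin n)) (G : Finset (Fin m)) : Prop :=
  ∀ x x' : Fin n → Bool,
    xor (x (I.vars cᵢ 0)) (x (I.vars cᵢ 1)) = xor (x' (I.vars cᵢ 0)) (x' (I.vars cᵢ 1)) → x (I.vars cᵢ 2) = x' (I.vars cᵢ 2) →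
    x (I.vars cᵢ 3) = x' (I.vars cᵢ 3) →
    xor (x (I.vars cⱼ 0)) (x (I.vars cⱼ 1)) = xor (x' (I.vars cⱼ 0)) (x' (I.vars cⱼ 1)) → x (I.vars cⱼ 2) = x' (I.vars cⱼ 2) →
    x (I.vars cⱼ 3) = x' (I.vars cⱼ 3) →
    (∀ v : Fin n, (∀ j ∈ J₀, v ∉ varSet I j) → x v = x' v) → gval I C G x = gval I C G x'

/-- **DOUBLE-SLICE GENERICITY of the pair `(cᵢ, cⱼ)`** (fibre values `y`, menu `𝒢`): a reader `(C, G)` with `G ⊆ 𝒢` not reading the four privates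
that misses a target `b` at EVERY solution of `J₀ ∖ {cᵢ, cⱼ}` with `x_{aᵢ} ⊕ x_{bᵢ} = tᵢ`, `x_{aⱼ} ⊕ x_{bⱼ} = tⱼ` depends only on these two bits and
the outside variables.  Certified numerically, not proved. -/
def DoubleSliceGeneric (I : LocalMap 4 n m) (y : Fin m → Bool) (J₀ : Finset (Fin m)) (cᵢ cⱼ : Fin m) (𝒢 : Finset (Fin m)) : Prop :=
  ∀ (C : Finset (Fin n)) (G : Finset (Fin m)) (tᵢ tⱼ b : Bool), I.vars cᵢ 2 ∉ C → I.vars cᵢ 3 ∉ C → I.vars cⱼ 2 ∉ C → I.vars cⱼ 3 ∉ C →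
    G ⊆ 𝒢 →
    (∀ x : Fin n → Bool, (∀ j ∈ (J₀.erase cᵢ).erase cⱼ, I.eval x j = y j) → xor (x (I.vars cᵢ 0)) (x (I.vars cᵢ 1)) = tᵢ →
      xor (x (I.vars cⱼ 0)) (x (I.vars cⱼ 1)) = tⱼ → gval I C G x ≠ b) →
    ∀ x x' : Fin n → Bool, xor (x (I.vars cᵢ 0)) (x (I.vars cᵢ 1)) = xor (x' (I.vars cᵢ 0)) (x' (I.vars cᵢ 1)) →
      xor (x (I.vars cⱼ 0)) (x (I.vars cⱼ 1)) = xor (x' (I.vars cⱼ 0)) (x' (I.vars cⱼ 1)) →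
      (∀ v : Fin n, (∀ j ∈ J₀, v ∉ varSet I j) → x v = x' v) → gval I C G x = gval I C G x'

section Main

variable {I : LocalMap 4 n m} {r : ℕ} {y : Fin m → Bool} {J₀ : Finset (Fin m)} {w₁ w₂ : Finset (Fin n) × Finset (Fin m) × Bool}
  {cᵢ cⱼ : Fin m} {𝒢 : Finset (Fin m)}

/-- **DOUBLE-SLICE LEMMA.**  A reader with monomials in the menu (avoiding both AND pairs) that fails on a private pattern of `(cᵢ, cⱼ)` is
bi-chord-local. -/
theorem biLocal_of_fail_pattern (hI : I.IsPure xorAndPred) (hcᵢ : cᵢ ∈ J₀) (hcⱼ : cⱼ ∈ J₀) (hne : cᵢ ≠ cⱼ) (hchᵢ : IsChord I J₀ cᵢ)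
    (hchⱼ : IsChord I J₀ cⱼ) (hgen : DoubleSliceGeneric I y J₀ cᵢ cⱼ 𝒢)
    (hmonoᵢ : ∀ g ∈ 𝒢, (I.vars g 2 ≠ I.vars cᵢ 2 ∧ I.vars g 3 ≠ I.vars cᵢ 2) ∧ (I.vars g 2 ≠ I.vars cᵢ 3 ∧ I.vars g 3 ≠ I.vars cᵢ 3))
    (hmonoⱼ : ∀ g ∈ 𝒢, (I.vars g 2 ≠ I.vars cⱼ 2 ∧ I.vars g 3 ≠ I.vars cⱼ 2) ∧ (I.vars g 2 ≠ I.vars cⱼ 3 ∧ I.vars g 3 ≠ I.vars cⱼ 3))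
    {C : Finset (Fin n)} {G : Finset (Fin m)} (hG : G ⊆ 𝒢) (πᵢ κᵢ πⱼ κⱼ b : Bool)
    (hfail : ∀ x : Fin n → Bool, (∀ j ∈ J₀, I.eval x j = y j) → x (I.vars cᵢ 2) = πᵢ → x (I.vars cᵢ 3) = κᵢ → x (I.vars cⱼ 2) = πⱼ →
      x (I.vars cⱼ 3) = κⱼ → gval I C G x ≠ b) :
    BiChordLocal I J₀ cᵢ cⱼ C G := by
  classical
  have hi23 : I.vars cᵢ 2 ≠ I.vars cᵢ 3 := fun h => absurd (hI.2 cᵢ h) (by decide)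
  have hj23 : I.vars cⱼ 2 ≠ I.vars cⱼ 3 := fun h => absurd (hI.2 cⱼ h) (by decide)
  obtain ⟨-, hi0p, hi0q, hi1p, hi1q⟩ := slots_ne hI (Or.inl ⟨rfl, rfl⟩ : (I.vars cᵢ 2 = I.vars cᵢ 2 ∧ I.vars cᵢ 3 = I.vars cᵢ 3) ∨ _)
  obtain ⟨-, hj0p, hj0q, hj1p, hj1q⟩ := slots_ne hI (Or.inl ⟨rfl, rfl⟩ : (I.vars cⱼ 2 = I.vars cⱼ 2 ∧ I.vars cⱼ 3 = I.vars cⱼ 3) ∨ _)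
  -- privates of one chord are outside the other chord
  have hpᵢ : I.vars cᵢ 2 ∉ varSet I cⱼ := not_mem_varSet_of_private I hcᵢ hcⱼ hne.symm hchᵢ.1 (vars_mem_varSet I cᵢ 2)
  have hqᵢ : I.vars cᵢ 3 ∉ varSet I cⱼ := not_mem_varSet_of_private I hcᵢ hcⱼ hne.symm hchᵢ.2 (vars_mem_varSet I cᵢ 3)
  have hpⱼ : I.vars cⱼ 2 ∉ varSet I cᵢ := not_mem_varSet_of_private I hcⱼ hcᵢ hne hchⱼ.1 (vars_mem_varSet I cⱼ 2)
  have hqⱼ : I.vars cⱼ 3 ∉ varSet I cᵢ := not_mem_varSet_of_private I hcⱼ hcᵢ hne hchⱼ.2 (vars_mem_varSet I cⱼ 3)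
  have nv : ∀ {u : Fin n} {c : Fin m}, u ∉ varSet I c → ∀ s : Fin 4, u ≠ I.vars c s := fun hu s e => hu (e ▸ vars_mem_varSet I _ s)
  -- the stripped reader
  set C₁ := (C.erase (I.vars cᵢ 2)).erase (I.vars cᵢ 3) with hC₁
  set C₂ := (C₁.erase (I.vars cⱼ 2)).erase (I.vars cⱼ 3) with hC₂
  have hC₁p : I.vars cᵢ 2 ∉ C₁ := fun h => notMem_erase _ _ (mem_of_mem_erase h)
  have hC₁q : I.vars cᵢ 3 ∉ C₁ := notMem_erase _ _
  have hC₂pⱼ : I.vars cⱼ 2 ∉ C₂ := fun h => notMem_erase _ _ (mem_of_mem_erase h)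
  have hC₂qⱼ : I.vars cⱼ 3 ∉ C₂ := notMem_erase _ _
  have hC₂pᵢ : I.vars cᵢ 2 ∉ C₂ := fun h => hC₁p (mem_of_mem_erase (mem_of_mem_erase h))
  have hC₂qᵢ : I.vars cᵢ 3 ∉ C₂ := fun h => hC₁q (mem_of_mem_erase (mem_of_mem_erase h))
  have hmonoGᵢ : ∀ g ∈ G, (I.vars g 2 ≠ I.vars cᵢ 2 ∧ I.vars g 3 ≠ I.vars cᵢ 2) ∧ (I.vars g 2 ≠ I.vars cᵢ 3 ∧ I.vars g 3 ≠ I.vars cᵢ 3) :=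
    fun g hg => hmonoᵢ g (hG hg)
  have hmonoGⱼ : ∀ g ∈ G, (I.vars g 2 ≠ I.vars cⱼ 2 ∧ I.vars g 3 ≠ I.vars cⱼ 2) ∧ (I.vars g 2 ≠ I.vars cⱼ 3 ∧ I.vars g 3 ≠ I.vars cⱼ 3) :=
    fun g hg => hmonoⱼ g (hG hg)
  -- split formula: `gval C G x = gval C₂ G x ⊕ (private bits)`
  have split : ∀ x : Fin n → Bool, gval I C G x =
      xor (xor (xor (xor (gval I C₂ G x) (decide (I.vars cⱼ 2 ∈ C₁) && x (I.vars cⱼ 2))) (decide (I.vars cⱼ 3 ∈ C₁) && x (I.vars cⱼ 3)))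
        (decide (I.vars cᵢ 2 ∈ C) && x (I.vars cᵢ 2))) (decide (I.vars cᵢ 3 ∈ C) && x (I.vars cᵢ 3)) := by
    intro x
    rw [gval_eq_split I hi23 C G x, ← hC₁, gval_eq_split I hj23 C₁ G x, ← hC₂]
  -- `C₂`-reader is the `C`-reader at the point with all four privates updated — it does not see them
  have hsetⱼ : IsChord I (J₀.erase cᵢ) cⱼ := isChord_of_subset I (erase_subset cᵢ J₀) (mem_erase.2 ⟨hne.symm, hcⱼ⟩) hchⱼ
  -- the stripped reader fails on the double slice `(tᵢ, tⱼ) = (y cᵢ ⊕ πᵢκᵢ, y cⱼ ⊕ πⱼκⱼ)`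
  have hfail' : ∀ x : Fin n → Bool, (∀ j ∈ (J₀.erase cᵢ).erase cⱼ, I.eval x j = y j) →
      xor (x (I.vars cᵢ 0)) (x (I.vars cᵢ 1)) = xor (y cᵢ) (πᵢ && κᵢ) → xor (x (I.vars cⱼ 0)) (x (I.vars cⱼ 1)) = xor (y cⱼ) (πⱼ && κⱼ) →
      gval I C₂ G x ≠ xor (xor (xor (xor b (decide (I.vars cⱼ 2 ∈ C₁) && πⱼ)) (decide (I.vars cⱼ 3 ∈ C₁) && κⱼ))
        (decide (I.vars cᵢ 2 ∈ C) && πᵢ)) (decide (I.vars cᵢ 3 ∈ C) && κᵢ) := by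
    intro x hx hsᵢ hsⱼ hval
    -- set the privates of `cⱼ` (in `J₀ ∖ cᵢ`), then of `cᵢ`
    have habⱼ : xor (xor (x (I.vars cⱼ 0)) (x (I.vars cⱼ 1))) (πⱼ && κⱼ) = y cⱼ := by
      rw [hsⱼ]; cases y cⱼ <;> cases (πⱼ && κⱼ) <;> rfl
    have hx₁ := solves_set_privates hI (mem_erase.2 ⟨hne.symm, hcⱼ⟩) hsetⱼ hx πⱼ κⱼ habⱼ
    set x₁ := Function.update (Function.update x (I.vars cⱼ 2) πⱼ) (I.vars cⱼ 3) κⱼ with hx₁def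
    have habᵢ : xor (xor (x₁ (I.vars cᵢ 0)) (x₁ (I.vars cᵢ 1))) (πᵢ && κᵢ) = y cᵢ := by
      rw [hx₁def, Function.update_of_ne (nv hqⱼ 0).symm, Function.update_of_ne (nv hpⱼ 0).symm, Function.update_of_ne (nv hqⱼ 1).symm,
        Function.update_of_ne (nv hpⱼ 1).symm, hsᵢ]
      cases y cᵢ <;> cases (πᵢ && κᵢ) <;> rfl
    have hx₂ := solves_set_privates hI hcᵢ hchᵢ hx₁ πᵢ κᵢ habᵢ
    set x₂ := Function.update (Function.update x₁ (I.vars cᵢ 2) πᵢ) (I.vars cᵢ 3) κᵢ with hx₂def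
    have e2ᵢ : x₂ (I.vars cᵢ 2) = πᵢ := by rw [hx₂def, Function.update_of_ne hi23, Function.update_self]
    have e3ᵢ : x₂ (I.vars cᵢ 3) = κᵢ := by rw [hx₂def, Function.update_self]
    have e2ⱼ : x₂ (I.vars cⱼ 2) = πⱼ := by
      rw [hx₂def, Function.update_of_ne (nv hpⱼ 3), Function.update_of_ne (nv hpⱼ 2), hx₁def, Function.update_of_ne hj23,
        Function.update_self]
    have e3ⱼ : x₂ (I.vars cⱼ 3) = κⱼ := by
      rw [hx₂def, Function.update_of_ne (nv hqⱼ 3), Function.update_of_ne (nv hqⱼ 2), hx₁def, Function.update_self]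
    refine hfail x₂ hx₂ e2ᵢ e3ᵢ e2ⱼ e3ⱼ ?_
    have hC₂x : gval I C₂ G x₂ = gval I C₂ G x := by
      rw [hx₂def, gval_update_pq I hC₂pᵢ hC₂qᵢ hmonoGᵢ, hx₁def, gval_update_pq I hC₂pⱼ hC₂qⱼ hmonoGⱼ]
    rw [split x₂, hC₂x, hval, e2ᵢ, e3ᵢ, e2ⱼ, e3ⱼ]
    cases b <;> cases (decide (I.vars cⱼ 2 ∈ C₁) && πⱼ) <;> cases (decide (I.vars cⱼ 3 ∈ C₁) && κⱼ) <;>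
      cases (decide (I.vars cᵢ 2 ∈ C) && πᵢ) <;> cases (decide (I.vars cᵢ 3 ∈ C) && κᵢ) <;> rfl
  have hloc := hgen C₂ G _ _ _ hC₂pᵢ hC₂qᵢ hC₂pⱼ hC₂qⱼ hG hfail'
  intro x x' hsᵢ hpᵢx hqᵢx hsⱼ hpⱼx hqⱼx hout
  rw [split x, split x', hloc x x' hsᵢ hsⱼ hout, hpᵢx, hqᵢx, hpⱼx, hqⱼx]

/-- **ENDGAME.**  Two bi-chord-local readers contradict (T3): the (M0) witness `ω` of a third output `f` satisfies the equations of `cᵢ, cⱼ`; a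
genuine solution with the same four privates exists (`exists_two_slices`, slice genericity of `cᵢ`), hence with the same chord data; giving it `ω`'s
values outside the core keeps it a solution and makes both readers take the witness's values. -/
theorem false_of_biLocal₂ (hI : I.IsPure xorAndPred) (ht : Terminal I r y J₀ w₁ w₂) (hcᵢ : cᵢ ∈ J₀) (hcⱼ : cⱼ ∈ J₀) (hne : cᵢ ≠ cⱼ)
    (hchᵢ : IsChord I J₀ cᵢ) (hchⱼ : IsChord I J₀ cⱼ) (hv : ∃ s : Fin 4, s.val < 2 ∧ I.vars cᵢ s ∉ varSet I cⱼ)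
    (hgenᵢ : SliceGeneric I y J₀ cᵢ 𝒢) {f : Fin m} (hf : f ∈ J₀) (hfᵢ : f ≠ cᵢ) (hfⱼ : f ≠ cⱼ)
    (h₁ : BiChordLocal I J₀ cᵢ cⱼ w₁.1 w₁.2.1) (h₂ : BiChordLocal I J₀ cᵢ cⱼ w₂.1 w₂.2.1) : False := by
  classical
  obtain ⟨ω, hω, hω₁, hω₂⟩ := ht.2.2.2.2.2.2.2 f hf
  have hωᵢ : I.eval ω cᵢ = y cᵢ := hω cᵢ (mem_erase.2 ⟨hfᵢ.symm, hcᵢ⟩)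
  have hωⱼ : I.eval ω cⱼ = y cⱼ := hω cⱼ (mem_erase.2 ⟨hfⱼ.symm, hcⱼ⟩)
  obtain ⟨x, hx, e2ᵢ, e3ᵢ, e2ⱼ, e3ⱼ⟩ :=
    exists_two_slices hI hcᵢ hcⱼ hne hchᵢ hchⱼ hv hgenᵢ (ω (I.vars cᵢ 2)) (ω (I.vars cᵢ 3)) (ω (I.vars cⱼ 2)) (ω (I.vars cⱼ 3))
  -- merge: core from `x`, outside from `ω`
  let x' : Fin n → Bool := fun v => if ∃ j ∈ J₀, v ∈ varSet I j then x v else ω v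
  have hcore : ∀ v, (∃ j ∈ J₀, v ∈ varSet I j) → x' v = x v := fun v hv => by simp only [x', if_pos hv]
  have hout : ∀ v, (∀ j ∈ J₀, v ∉ varSet I j) → x' v = ω v := fun v hv => by
    have : ¬ ∃ j ∈ J₀, v ∈ varSet I j := fun ⟨j, hj, hvj⟩ => hv j hj hvj
    simp only [x', if_neg this]
  have hx' : ∀ j ∈ J₀, I.eval x' j = y j := fun j hj => by
    rw [eval_congr I j (fun s => hcore _ ⟨j, hj, vars_mem_varSet I j s⟩)]; exact hx j hj
  have hvᵢ : ∀ s, x' (I.vars cᵢ s) = x (I.vars cᵢ s) := fun s => hcore _ ⟨cᵢ, hcᵢ, vars_mem_varSet I cᵢ s⟩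
  have hvⱼ : ∀ s, x' (I.vars cⱼ s) = x (I.vars cⱼ s) := fun s => hcore _ ⟨cⱼ, hcⱼ, vars_mem_varSet I cⱼ s⟩
  -- chord data of `x'` and `ω` agree
  have hsᵢ : xor (x' (I.vars cᵢ 0)) (x' (I.vars cᵢ 1)) = xor (ω (I.vars cᵢ 0)) (ω (I.vars cᵢ 1)) := by
    rw [hvᵢ, hvᵢ, xor_eq_of_eval hI (hx cᵢ hcᵢ), xor_eq_of_eval hI hωᵢ, e2ᵢ, e3ᵢ]
  have hsⱼ : xor (x' (I.vars cⱼ 0)) (x' (I.vars cⱼ 1)) = xor (ω (I.vars cⱼ 0)) (ω (I.vars cⱼ 1)) := by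
    rw [hvⱼ, hvⱼ, xor_eq_of_eval hI (hx cⱼ hcⱼ), xor_eq_of_eval hI hωⱼ, e2ⱼ, e3ⱼ]
  have hpᵢ : x' (I.vars cᵢ 2) = ω (I.vars cᵢ 2) := by rw [hvᵢ, e2ᵢ]
  have hqᵢ : x' (I.vars cᵢ 3) = ω (I.vars cᵢ 3) := by rw [hvᵢ, e3ᵢ]
  have hpⱼ : x' (I.vars cⱼ 2) = ω (I.vars cⱼ 2) := by rw [hvⱼ, e2ⱼ]
  have hqⱼ : x' (I.vars cⱼ 3) = ω (I.vars cⱼ 3) := by rw [hvⱼ, e3ⱼ]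
  refine ht.2.2.2.2.2.2.1 ⟨x', hx', ?_, ?_⟩
  · rw [h₁ x' ω hsᵢ hpᵢ hqᵢ hsⱼ hpⱼ hqⱼ hout]; exact hω₁
  · rw [h₂ x' ω hsᵢ hpᵢ hqᵢ hsⱼ hpⱼ hqⱼ hout]; exact hω₂

/-- **THE PINNED BRANCH.**  A terminal core has no private pattern of two distinct double-slice-generic chords on which BOTH readers miss a value
(readers' monomials avoiding both AND pairs; a third output exists). -/
theorem false_of_pinned_pattern (hI : I.IsPure xorAndPred) (ht : Terminal I r y J₀ w₁ w₂) (hcᵢ : cᵢ ∈ J₀) (hcⱼ : cⱼ ∈ J₀)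
    (hne : cᵢ ≠ cⱼ) (hchᵢ : IsChord I J₀ cᵢ) (hchⱼ : IsChord I J₀ cⱼ) (hv : ∃ s : Fin 4, s.val < 2 ∧ I.vars cᵢ s ∉ varSet I cⱼ)
    (hgenᵢ : SliceGeneric I y J₀ cᵢ (w₁.2.1 ∪ w₂.2.1)) (hgen : DoubleSliceGeneric I y J₀ cᵢ cⱼ (w₁.2.1 ∪ w₂.2.1))
    (hmonoᵢ : ∀ g ∈ w₁.2.1 ∪ w₂.2.1,
      (I.vars g 2 ≠ I.vars cᵢ 2 ∧ I.vars g 3 ≠ I.vars cᵢ 2) ∧ (I.vars g 2 ≠ I.vars cᵢ 3 ∧ I.vars g 3 ≠ I.vars cᵢ 3))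
    (hmonoⱼ : ∀ g ∈ w₁.2.1 ∪ w₂.2.1,
      (I.vars g 2 ≠ I.vars cⱼ 2 ∧ I.vars g 3 ≠ I.vars cⱼ 2) ∧ (I.vars g 2 ≠ I.vars cⱼ 3 ∧ I.vars g 3 ≠ I.vars cⱼ 3))
    {f : Fin m} (hf : f ∈ J₀) (hfᵢ : f ≠ cᵢ) (hfⱼ : f ≠ cⱼ) (πᵢ κᵢ πⱼ κⱼ v₁ v₂ : Bool)
    (hfail₁ : ∀ x : Fin n → Bool, (∀ j ∈ J₀, I.eval x j = y j) → x (I.vars cᵢ 2) = πᵢ → x (I.vars cᵢ 3) = κᵢ → x (I.vars cⱼ 2) = πⱼ →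
      x (I.vars cⱼ 3) = κⱼ → gval I w₁.1 w₁.2.1 x ≠ v₁)
    (hfail₂ : ∀ x : Fin n → Bool, (∀ j ∈ J₀, I.eval x j = y j) → x (I.vars cᵢ 2) = πᵢ → x (I.vars cᵢ 3) = κᵢ → x (I.vars cⱼ 2) = πⱼ →
      x (I.vars cⱼ 3) = κⱼ → gval I w₂.1 w₂.2.1 x ≠ v₂) : False :=
  false_of_biLocal₂ hI ht hcᵢ hcⱼ hne hchᵢ hchⱼ hv hgenᵢ hf hfᵢ hfⱼ
    (biLocal_of_fail_pattern hI hcᵢ hcⱼ hne hchᵢ hchⱼ hgen hmonoᵢ hmonoⱼ subset_union_left πᵢ κᵢ πⱼ κⱼ v₁ hfail₁)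
    (biLocal_of_fail_pattern hI hcᵢ hcⱼ hne hchᵢ hchⱼ hgen hmonoᵢ hmonoⱼ subset_union_right πᵢ κᵢ πⱼ κⱼ v₂ hfail₂)

end Main

end Summit.PneNP.PneNP.Theorems.PstarChordReadBiLocal
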